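import Literature.MathematicalPhysics.QuantumFieldTheory.Balaban1983to89.B11Ineq189Transpose
import Literature.MathematicalPhysics.QuantumFieldTheory.Balaban1983to89.B11SupSize190

/-!
# `Balaban1983to89.B11Ineq189TransposeScalar` — [Balaban1985Variational] p. 308 (189) ∕ [Balaban1984PropagatorsII] (2.51):
# the SCALAR MODEL of the transposition letters of `B11Ineq189Transpose` — duality, block Hölder and the adjoint
# identity are THEOREMS for real kernels between the sharp-block sup sizes of `B11SupSize190.supSize`

statement-level skeleton of published theorems with citation tags; proofs where landed; nothing here is a claim about
the Yang–Mills mass gap.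

CITATION HEADER (lean-in-tree rule 2026-08-18).  [Balaban1984PropagatorsII] = T. Bałaban, *Propagators and renormalization
transformations for lattice gauge theories. II*, Commun. Math. Phys. **96** (1984) 223–250, (2.51)–(2.53) p. 232 (kernel
bounds between blocks and the partition of unity `Σ_y Δ(y) = I`); [Balaban1985Variational] (189)–(190) p. 308 (the sizes
«for x ∈ Δ(y)»).  Nothing of either paper is asserted: this module is [folklore] finite-dimensional duality on the
vocabulary `B11SectG.BlockNorm` ∕ `HasMaj` ∕ `B11Ineq189.HasMaj₂` ∕ `B11SupSize190.supSize`.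

WHY (YM-DAG node N07 = [B11], -b₂ seat `pub-ymgap-dag-n21-b` g2; companion of `B11Ineq189Transpose`): the transposition
theorems `hasMaj_transpose_of_adjoint` ∕ `hasMaj₂_transpose_of_adjoint` carry three pairing LETTERS as hypotheses
(adjoint identity, duality of a block size against a pairing with constant `C`, block Hölder with constant `N`).  THIS FILE
shows they are jointly satisfiable with a non-trivial conclusion — in the scalar model they are THEOREMS: for real-valued
lattice functions on finite point sets `X`, `Y` with the sharp-block sup sizes (`box y` = the block of `y`), the dot
product `μ·f = Σ_x μ(x)f(x)` and a real kernel `A : Y × X → ℝ`: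
* `mulVec_dot_eq_dot_transpose_mulVec` — `(Aμ)·w = μ·(Aᵀw)` (the adjoint of `A·` is `Aᵀ·`);
* `dual_supSize_dot` — DUALITY with `C = 1`: the size of `f` at `y` is at most any common bound of the pairings `μ·f`,
  `μ` localised in the block of `y` with size `≤ 1` (witness: the signed indicator of the point of the block where `|f|` is
  largest);
* `holder_supSize_dot` — BLOCK HÖLDER: `f·w ≤ N·loc_y f·loc_y w` for `w` localised in the block of `y`, `N ≥ max_y #Δ(y)`;
* **`hasMaj_transpose_scalar`** — hence a majorant `K(y, y′) ≥ 0` of `μ ↦ Aμ` between the sharp-block sup sizes IS the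
  majorant `N·K(y′, y)` of `w ↦ Aᵀw` ([3] (2.51) «transposed»: the kernel numbers are orientation-free, the block SIZES
  cost the block cardinality `N`), and the family version **`hasMaj₂_transpose_scalar`** (`Φ𝔄 = A(𝔄)·`,
  `Φᵗ𝔄 = A(𝔄)ᵀ·`: joint majorant `K(y,y″,y′) ↦ N·K(y″,y,y′)`).

HONEST SCOPE.  The scalar model only (real values, dot product); the gauge-field instance — the trace form
`Σ_b Re tr A(b)*B(b)` on `Matrix n n ℂ`-valued bond configurations over `cubeGeometry`, `N = n·#Δ(y)` — is the
definition-lane companion.  No `def`, no `instance`, no `notation`; 0 sorry; axioms standard.  One finite T⁴ programme at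
fixed `ε` upstream — NOT infinite volume, NOT OS on ℝ⁴, NOT a mass gap, NOT Clay.
-/

namespace Literature.MathematicalPhysics.QuantumFieldTheory.Balaban1983to89.B11Ineq189TransposeScalar

open Finset B6RandomWalk B11SectG B11Ineq189 B11SupSize190 B11Ineq189Transpose

variable {g : B6.Geometry}
variable {FA : Type} [AddCommGroup FA] [Module ℝ FA]

/-! ## The scalar model: the three pairing letters are THEOREMS for real kernels between sharp-block sup sizes -/

section Scalar

open scoped Matrix

variable {X Y : Type} [Fintype X] [Fintype Y] [DecidableEq X] [DecidableEq g.Site]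

omit [DecidableEq X] in
/-- The adjoint of `μ ↦ Aμ` for the dot product is `w ↦ Aᵀw`: `(Aμ)·w = μ·(Aᵀw)` — the scalar model of the transposed
kernels of [3] (2.51). [cite: Balaban1984PropagatorsII, (2.51) p.232] -/
theorem mulVec_dot_eq_dot_transpose_mulVec (A : Matrix Y X ℝ) (μ : X → ℝ) (w : Y → ℝ) :
    (A *ᵥ μ) ⬝ᵥ w = μ ⬝ᵥ (Aᵀ *ᵥ w) := by
  rw [Matrix.mulVec_transpose, dotProduct_comm (A *ᵥ μ) w, Matrix.dotProduct_mulVec, dotProduct_comm]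

/-- **DUALITY, scalar model** (`C = 1`): for the sharp-block sup size of real-valued functions (`box y` = the block of `y`),
the size of `f` at `y` is at most any common bound `s` of the pairings `μ·f` over the test functions `μ` localised in the block
of `y` with size `≤ 1` — witnessed by the signed indicator of the point of the block where `|f|` is largest (the sup size
*«for x ∈ Δ(y)»* of (190) read against the dot product). [cite: Balaban1985Variational, (190) p.308] -/
theorem dual_supSize_dot (blk : X → g.Site) (y : g.Site) (f : X → ℝ) (s : ℝ)
    (hs : ∀ μ : X → ℝ,
      (supSize g (fun z => Finset.univ.filter fun x => blk x = z) blk : BlockNorm g (X → ℝ)).IsLoc y μ →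
      (supSize g (fun z => Finset.univ.filter fun x => blk x = z) blk : BlockNorm g (X → ℝ)).loc y μ ≤ 1 →
      μ ⬝ᵥ f ≤ s) :
    (supSize g (fun z => Finset.univ.filter fun x => blk x = z) blk : BlockNorm g (X → ℝ)).loc y f ≤ 1 * s := by
  rw [one_mul]
  have hs0 : 0 ≤ s := by
    have h0 := hs 0 (fun _ _ => rfl) (by
      rw [(supSize g (fun z => Finset.univ.filter fun x => blk x = z) blk : BlockNorm g (X → ℝ)).loc_zero]
      exact zero_le_one)
    rwa [zero_dotProduct] at h0
  refine loc_le_of_forall hs0 fun x hx => ?_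
  have hbx : blk x = y := (Finset.mem_filter.1 hx).2
  -- the signed indicator of the point `x`
  set σx : ℝ := if 0 ≤ f x then 1 else -1 with hσx
  have hσ1 : |σx| ≤ 1 := by
    rw [hσx]; split_ifs <;> simp
  have hloc : (supSize g (fun z => Finset.univ.filter fun x => blk x = z) blk : BlockNorm g (X → ℝ)).IsLoc y
      (Pi.single x σx) := by
    intro x' hx'
    have hne : x' ≠ x := fun h => hx' (h ▸ hbx)
    simp [Pi.single_eq_of_ne hne]
  have hle1 : (supSize g (fun z => Finset.univ.filter fun x => blk x = z) blk : BlockNorm g (X → ℝ)).loc y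
      (Pi.single x σx) ≤ 1 := by
    refine loc_le_of_forall zero_le_one fun x' _ => ?_
    by_cases h : x' = x
    · subst h
      simpa [Real.norm_eq_abs] using hσ1
    · simp [Pi.single_eq_of_ne h]
  have key := hs (Pi.single x σx) hloc hle1
  rw [single_dotProduct] at key
  rw [Real.norm_eq_abs]
  by_cases h : 0 ≤ f x
  · rw [abs_of_nonneg h]
    simpa [hσx, h] using key
  · have h : f x < 0 := lt_of_not_ge h
    rw [abs_of_neg h]
    have : σx = -1 := by rw [hσx, if_neg (not_le.2 h)]
    rw [this] at key
    linarith

omit [DecidableEq X] in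
/-- **BLOCK HÖLDER, scalar model**: a function `w` localised in the block of `y` pairs with any `f` to at most
`N·loc_y f·loc_y w`, `N` any bound of the block cardinalities (the sup size *«for x ∈ Δ(y)»* of (190) read against the
dot product). [cite: Balaban1985Variational, (190) p.308] -/
theorem holder_supSize_dot (blk : X → g.Site) {N : ℝ}
    (hN : ∀ y : g.Site, ((Finset.univ.filter fun x => blk x = y).card : ℝ) ≤ N) (y : g.Site) (w : X → ℝ)
    (hw : (supSize g (fun z => Finset.univ.filter fun x => blk x = z) blk : BlockNorm g (X → ℝ)).IsLoc y w)
    (f : X → ℝ) :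
    f ⬝ᵥ w ≤ N * ((supSize g (fun z => Finset.univ.filter fun x => blk x = z) blk : BlockNorm g (X → ℝ)).loc y f *
      (supSize g (fun z => Finset.univ.filter fun x => blk x = z) blk : BlockNorm g (X → ℝ)).loc y w) := by
  set b : BlockNorm g (X → ℝ) := supSize g (fun z => Finset.univ.filter fun x => blk x = z) blk with hb
  have hsplit : f ⬝ᵥ w = ∑ x ∈ Finset.univ.filter (fun x => blk x = y), f x * w x := by
    rw [dotProduct, ← Finset.sum_filter_add_sum_filter_not Finset.univ (fun x => blk x = y)]
    have h0 : ∑ x ∈ Finset.univ.filter (fun x => ¬ blk x = y), f x * w x = 0 :=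
      Finset.sum_eq_zero fun x hx => by rw [hw x (Finset.mem_filter.1 hx).2, mul_zero]
    rw [h0, add_zero]
  have hf0 : 0 ≤ b.loc y f := b.loc_nonneg _ _
  have hw0 : 0 ≤ b.loc y w := b.loc_nonneg _ _
  have hcard := hN y
  rw [hsplit]
  calc ∑ x ∈ Finset.univ.filter (fun x => blk x = y), f x * w x
      ≤ ∑ x ∈ Finset.univ.filter (fun x => blk x = y), b.loc y f * b.loc y w := by
        refine Finset.sum_le_sum fun x hx => ?_
        have h1 : |f x| ≤ b.loc y f := by
          rw [hb, supSize_loc, ← Real.norm_eq_abs]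
          exact norm_le_supNorm f hx
        have h2 : |w x| ≤ b.loc y w := by
          rw [hb, supSize_loc, ← Real.norm_eq_abs]
          exact norm_le_supNorm w hx
        calc f x * w x ≤ |f x * w x| := le_abs_self _
          _ = |f x| * |w x| := abs_mul _ _
          _ ≤ b.loc y f * b.loc y w := mul_le_mul h1 h2 (abs_nonneg _) hf0
    _ = ((Finset.univ.filter fun x => blk x = y).card : ℝ) * (b.loc y f * b.loc y w) := by
        rw [Finset.sum_const, nsmul_eq_mul]
    _ ≤ N * (b.loc y f * b.loc y w) := mul_le_mul_of_nonneg_right hcard (mul_nonneg hf0 hw0)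

/-- **THE SCALAR TRANSPOSITION THEOREM** ([3] (2.51) «transposed», no pairing hypothesis left): if the real kernel `A`
(as the operator `μ ↦ Aμ` from functions on `X` to functions on `Y`) has the majorant `K ≥ 0` between the sharp-block sup
sizes, then `w ↦ Aᵀw` has the majorant `N·K(y′, y)`, `N` any bound of the block cardinalities of `Y` — the three letters
of §1 discharged by `dual_supSize_dot`, `holder_supSize_dot`, `mulVec_dot_eq_dot_transpose_mulVec`.
[cite: Balaban1984PropagatorsII, (2.51)–(2.53) p.232] -/
theorem hasMaj_transpose_scalar (blkX : X → g.Site) (blkY : Y → g.Site) (A : Matrix Y X ℝ)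
    {K : g.Site → g.Site → ℝ} {N : ℝ} (hK : ∀ y y', 0 ≤ K y y')
    (hN : ∀ y : g.Site, ((Finset.univ.filter fun x => blkY x = y).card : ℝ) ≤ N)
    (h : HasMaj (supSize g (fun z => Finset.univ.filter fun x => blkX x = z) blkX : BlockNorm g (X → ℝ))
      (supSize g (fun z => Finset.univ.filter fun x => blkY x = z) blkY : BlockNorm g (Y → ℝ)) A.mulVecLin K) :
    HasMaj (supSize g (fun z => Finset.univ.filter fun x => blkY x = z) blkY : BlockNorm g (Y → ℝ))
      (supSize g (fun z => Finset.univ.filter fun x => blkX x = z) blkX : BlockNorm g (X → ℝ)) Aᵀ.mulVecLin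
      (fun y y' => 1 * N * K y' y) := by
  by_cases hY : Nonempty g.Site
  · obtain ⟨y₁⟩ := hY
    have hN0 : 0 ≤ N := (Nat.cast_nonneg _).trans (hN y₁)
    exact hasMaj_transpose_of_adjoint (p₁ := fun μ f => μ ⬝ᵥ f) (p₂ := fun f w => f ⬝ᵥ w) hN0 hK
      (fun μ w => by
        simp only [Matrix.mulVecLin_apply]
        exact mulVec_dot_eq_dot_transpose_mulVec A μ w)
      (fun y f s hs => dual_supSize_dot blkX y f s hs) (fun y w hw f => holder_supSize_dot blkY hN y w hw f) h
  · intro y₃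
    exact absurd ⟨y₃⟩ hY

/-- **THE SCALAR TRANSPOSITION THEOREM FOR `𝔄`-DEPENDENT FAMILIES**: a family `Φ𝔄 = A(𝔄)·` of real kernels (ANY map
`𝔄 ↦ A(𝔄)`, read through the two linear families `Φ`, `Φᵗ` with `Φ𝔄μ = A(𝔄)μ`, `Φᵗ𝔄w = A(𝔄)ᵀw`) with joint majorant
`K(y, y″, y′) ≥ 0` between sharp-block sup sizes has the transposed joint majorant `N·K(y″, y, y′)` — §1's
`hasMaj₂_transpose_of_adjoint` with its three letters discharged in the scalar model.
[cite: Balaban1984PropagatorsII, (2.51)–(2.53) p.232] -/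
theorem hasMaj₂_transpose_scalar {bA : BlockNorm g FA} (blkX : X → g.Site) (blkY : Y → g.Site)
    (A : FA → Matrix Y X ℝ) {Φ : FA →ₗ[ℝ] (X → ℝ) →ₗ[ℝ] (Y → ℝ)} {Φt : FA →ₗ[ℝ] (Y → ℝ) →ₗ[ℝ] (X → ℝ)}
    (hΦ : ∀ v μ, Φ v μ = A v *ᵥ μ) (hΦt : ∀ v w, Φt v w = (A v)ᵀ *ᵥ w)
    {K : g.Site → g.Site → g.Site → ℝ} {N : ℝ} (hK : ∀ y y'' y', 0 ≤ K y y'' y')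
    (hN : ∀ y : g.Site, ((Finset.univ.filter fun x => blkY x = y).card : ℝ) ≤ N)
    (h : HasMaj₂ bA (supSize g (fun z => Finset.univ.filter fun x => blkX x = z) blkX : BlockNorm g (X → ℝ))
      (supSize g (fun z => Finset.univ.filter fun x => blkY x = z) blkY : BlockNorm g (Y → ℝ)) Φ K) :
    HasMaj₂ bA (supSize g (fun z => Finset.univ.filter fun x => blkY x = z) blkY : BlockNorm g (Y → ℝ))
      (supSize g (fun z => Finset.univ.filter fun x => blkX x = z) blkX : BlockNorm g (X → ℝ)) Φt
      (fun y y'' y' => 1 * N * K y'' y y') := by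
  by_cases hY : Nonempty g.Site
  · obtain ⟨y₁⟩ := hY
    have hN0 : 0 ≤ N := (Nat.cast_nonneg _).trans (hN y₁)
    exact hasMaj₂_transpose_of_adjoint (p₁ := fun μ f => μ ⬝ᵥ f) (p₂ := fun f w => f ⬝ᵥ w) hN0 hK
      (fun v μ w => by
        rw [hΦ, hΦt]
        exact mulVec_dot_eq_dot_transpose_mulVec (A v) μ w)
      (fun y f s hs => dual_supSize_dot blkX y f s hs) (fun y w hw f => holder_supSize_dot blkY hN y w hw f) h
  · intro y'
    exact absurd ⟨y'⟩ hY

end Scalar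

end Literature.MathematicalPhysics.QuantumFieldTheory.Balaban1983to89.B11Ineq189TransposeScalar
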